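import Summits.QuantumFields.YangMills.Theorems.UnitScaleTiltProp7CovPinnedKernelL1OfRowsWindow
import Summits.QuantumFields.YangMills.Theorems.UnitScaleTiltProp7CovInterpKernelDual
import Summits.QuantumFields.YangMills.Theorems.UnitScaleTiltProp7PinnedCovBiharmonicSolve
import HarnessLib

/-!
# Route `UnitScaleTilt`, crux K1 «MinimiserStabilityRegPr» (stmt-QuantumFields-19200), route-R E′ path (α′), (E1-b) at the CURVED background — THE (A-cov) ASSEMBLY DOOR:
# `hker` OF ✓p670099 (`∀ X, ∃ w` pinned, `Δ_U²w =` covariant dipole off the centres, `Σ_z √hs(Δ_Uw z) ≤ κ·√hs X`) FROM ANY TRANSPLANT `V` WHOSE COVARIANT BI-LAPLACIAN OFF THE CENTRES IS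
# «dipole + Δ_U h + s» — the junk `Δ_U h + s` is removed by its pinned response (existence ✓p670409), which costs `W·(3‖ωh‖ + 5A‖ωs‖)` through the two cheap channels of the covariant
# door ✓p674320; the main part costs the type-1 door's `W·3N_h + N₂ + N₃ + W·3N₄`; and the interpolation row `√hs(D_U(φ − φ_H)(x,μ)) ≤ κ·s₁` (= the `hKsup` binder of ✓p675883) follows by ✓p670099

Cell `ym3-torus`, width seat `ym3-torus-px22` (gen 3), on ★routeR-w3 g6's WORD (13) «(A-cov) INSTANTIATION» + routeR-w6 g6 22:57Z; this file FIXES BY KERNEL what the transplant generations (gen-0 ✓p675919,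
gen-1 `…TransplantNormsField` + LOCATE-PCOV2 §6 (ID)) must export: ONE pointwise identity `hV` off the centres and SIX numbers.  THEOREMS ONLY (0 `def`, 0 `sorry`); `--supports stmt-QuantumFields-19200`,
count-neutral.  YM₃ on T³ is a ladder rung (R3), not the Clay problem; nothing here claims the stub, the crux, d = 4 or the gap.

WHAT IS PROVED (ns `…Theorems.Prop7CovKernelOfTransplant`; torus `Site P i`, `T = torusT P i`, unitary `U`, centres `C : Set`, `Δ_Uf x := divB T U (fun μ => covD T U μ f) x`, `hs X = Σ_{jk}‖X j k‖²`,
weight∕Poincaré∕window rows `hω₀ hω₁ hω₂ hP ha hwin₁ hwin₂ hW` = px4 g3's ✓`Prop7CovAgmonWindow` letters VERBATIM, pinned solvability `hsolve` = ✓`Prop7PinnedCovBiharmonicSolve.exists_pinned_covBilaplace_eq_off` shape).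
* §1 letters: `covLaplace_zero`, `covBilaplace_sub`.
* §2 ★★ `sum_sqrt_hs_covLaplace_response_le` — THE JUNK CHANNEL: a pinned `w_J` with `Δ_U²w_J = Δ_U h + s` off `C` has `Σ_z √hs(Δ_Uw_J z) ≤ W·(3·‖ωh‖₂ + 5A·‖ωs‖₂)` (the door at `χ = 0`, `U_int = u = U₂ = 0`).
* §3 ★★★ `exists_pinned_dipole_field_of_transplant` — given the transplant `V` with `hV : ∀ z ∉ C, Δ_U²V z = dipole z + (Δ_U h z + s z)`, a cutoff `χ`, a near datum `u` (`u|_C = (χ•V)|_C`) and the six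
  numbers `N_h N₂ N₃ N₄ H S`: `∃ w`, pinned, `Δ_U²w = dipole` off `C` EXACTLY, `Σ_z √hs(Δ_Uw z) ≤ W·3N_h + N₂ + N₃ + W·3N₄ + W·(3H + 5A·S)` (`w := (V − U_int) − w_J`).
* §4 ★★★ `sqrt_hs_covD_interp_error_le_of_transplant` — per-`X` transplant data with total `≤ κ·√hs X` ⇒ `√hs(D_U(φ − φ_H)(x,μ)) ≤ κ·s₁` (✓p670099 with `hker` discharged); ★★★ `hKsup_of_transplant_T3` —
  the T³ reading in the EXACT binder shape `hKsup` of ✓ `Prop7LinearCorrectorClose.linCorr_gauge_le_of_supplier_rows` (run `K`, level `K − n`, `SU(2)` background `W`, `hsolve` discharged by ✓p670409).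
HONEST SCOPE.  Bookkeeping over landed doors; the transplant identity `hV`, the six numbers, and the member's weight∕Poincaré rows stay DISPLAYED (gen-0∕gen-1, CONE-INST, (D1-cov)∕(D2′-cov) at the member).

References: T. Bałaban, CMP 99 (1985) 75–102 [Balaban1985RegularSpaces] ((1.14) p.78, (1.36) p.82); CMP 96 (1984) 223–250 [Balaban1984PropagatorsII] ((1.9) p.226); CMP 99 (1985) 389–434
[Balaban1985BackgroundPropagators] ((3.3) p.390, (3.8) p.392); CMP 102 (1985) 277–309 [Balaban1985Variational] (Prop. 7 p.299).
-/

set_option autoImplicit false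

noncomputable section

open scoped BigOperators Matrix

namespace Summit.QuantumFields.YangMills.Theorems.Prop7CovKernelOfTransplant

open Literature.MathematicalPhysics.QuantumFieldTheory.Balaban1983to89
open B9Eq39Adjoint (R R_def covD covDstar divB)
open B9TorusCalculus (torusT)
open Summit.QuantumFields.YangMills.Theorems.Prop7CovInterpKernelDual (covLaplace_sub sum_re_trace_covLaplace_comm sqrt_hs_covD_interp_error_le)
open Summit.QuantumFields.YangMills.Theorems.Prop7CovPinnedPeelingEL (reTr_add_left)
open Summit.QuantumFields.YangMills.Theorems.Prop7CovPinnedKernelL1OfRows (sum_sqrt_hs_covLaplace_sub_le)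
open Summit.QuantumFields.YangMills.Theorems.Prop7CovPinnedKernelL1OfRowsCore (sum_hs_zero)
open Summit.QuantumFields.YangMills.Theorems.Prop7CovPinnedKernelL1OfRowsWindow (sum_sqrt_hs_covLaplace_sub_interp_le_of_rows_window
  sum_sqrt_hs_covLaplace_sub_interp_le_type_one_window)

variable {P : Params} {i : ℕ} {N : ℕ}
variable {U : Fin P.d → Site P i → (Matrix (Fin N) (Fin N) ℂ)ˣ}

/-! ## §1 Letters -/

variable (U) in
/-- `Δ_U 0 = 0`. [cite: Balaban1985BackgroundPropagators, (3.8) p.392] -/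
theorem covLaplace_zero (x : Site P i) :
    divB (torusT P i) U (fun μ => covD (torusT P i) U μ (fun _ : Site P i => (0 : Matrix (Fin N) (Fin N) ℂ))) x = 0 := by
  simp only [divB, covDstar, covD, R_def, mul_zero, zero_mul, sub_zero, Finset.sum_const_zero]

/-- `Δ_U²(f − g) = Δ_U²f − Δ_U²g` pointwise. [cite: Balaban1985BackgroundPropagators, (3.8) p.392] -/
theorem covBilaplace_sub (f g : Site P i → Matrix (Fin N) (Fin N) ℂ) (x : Site P i) :
    divB (torusT P i) U (fun μ => covD (torusT P i) U μ
        (fun y => divB (torusT P i) U (fun ν => covD (torusT P i) U ν (fun z => f z - g z)) y)) x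
      = divB (torusT P i) U (fun μ => covD (torusT P i) U μ
          (fun y => divB (torusT P i) U (fun ν => covD (torusT P i) U ν f) y)) x
        - divB (torusT P i) U (fun μ => covD (torusT P i) U μ
          (fun y => divB (torusT P i) U (fun ν => covD (torusT P i) U ν g) y)) x := by
  have e : (fun y => divB (torusT P i) U (fun ν => covD (torusT P i) U ν (fun z => f z - g z)) y)
      = fun y => divB (torusT P i) U (fun ν => covD (torusT P i) U ν f) y - divB (torusT P i) U (fun ν => covD (torusT P i) U ν g) y :=
    funext fun y => covLaplace_sub f g y
  rw [e, covLaplace_sub]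

/-! ## §2 ★★ The junk channel: the pinned response of `Δ_U h + s` -/

/-- ★★ **THE JUNK CHANNEL.**  Unitary `U`, centres `C`, px4 g3's weight∕Poincaré∕window rows.  A pinned field `w_J` (`w_J|_C = 0`) whose covariant bi-Laplacian off `C` is `Δ_U h + s` has
`Σ_z √hs(Δ_U w_J z) ≤ W·(3·H + 5A·S)` whenever `√Σω²hs(h) ≤ H` and `√Σω²hs(s) ≤ S` — the covariant door ✓ `…OfRowsWindow.sum_sqrt_hs_covLaplace_sub_interp_le_of_rows_window` at `χ = 0`,
`U_int = u = U₂ = 0`, `ht = 0` (its `hEL` identity is Green's second identity for `Δ_U`, ✓ `sum_re_trace_covLaplace_comm`).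
[cite: Balaban1984PropagatorsII, (1.9) p.226; Balaban1985RegularSpaces, (1.36) p.82; Balaban1985BackgroundPropagators, (3.8) p.392] -/
theorem sum_sqrt_hs_covLaplace_response_le (hU : ∀ ν x, (U ν x : Matrix (Fin N) (Fin N) ℂ) ∈ unitary (Matrix (Fin N) (Fin N) ℂ))
    (C : Set (Site P i)) (ω : Site P i → ℝ) {a b A W H S : ℝ} (ha0 : 0 ≤ a) (hb0 : 0 ≤ b) (hA : 0 ≤ A)
    (hω₀ : ∀ x, 0 < ω x)
    (hω₁ : ∀ x μ, |ω (x.shift μ) - ω x| ≤ a * ω x ∧ |ω (x.unshift μ) - ω x| ≤ a * ω x)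
    (hω₂ : ∀ x μ, |ω (x.shift μ) + ω (x.unshift μ) - 2 * ω x| ≤ b * ω x)
    (hP : ∀ v : Site P i → Matrix (Fin N) (Fin N) ℂ, (∀ y ∈ C, v y = 0) →
      Real.sqrt (∑ x, ∑ j : Fin N, ∑ k : Fin N, ‖(v x) j k‖ ^ 2)
        ≤ A * Real.sqrt (∑ x, ∑ j : Fin N, ∑ k : Fin N, ‖(divB (torusT P i) U (fun μ => covD (torusT P i) U μ v) x) j k‖ ^ 2))
    (ha : a ≤ 1 / 2) (hwin₁ : a * Real.sqrt P.d * Real.sqrt A ≤ 1 / 100) (hwin₂ : b * P.d * A ≤ 1 / 50)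
    (hW : Real.sqrt (∑ z, (ω z)⁻¹ ^ 2) ≤ W)
    (wJ h s : Site P i → Matrix (Fin N) (Fin N) ℂ) (hwJ0 : ∀ y ∈ C, wJ y = 0)
    (hwJ : ∀ z ∉ C, divB (torusT P i) U (fun μ => covD (torusT P i) U μ
      (fun y => divB (torusT P i) U (fun ν => covD (torusT P i) U ν wJ) y)) z
        = divB (torusT P i) U (fun μ => covD (torusT P i) U μ h) z + s z)
    (hH : Real.sqrt (∑ x, ω x ^ 2 * ∑ j : Fin N, ∑ k : Fin N, ‖(h x) j k‖ ^ 2) ≤ H)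
    (hS : Real.sqrt (∑ x, ω x ^ 2 * ∑ j : Fin N, ∑ k : Fin N, ‖(s x) j k‖ ^ 2) ≤ S) :
    ∑ z, Real.sqrt (∑ j : Fin N, ∑ k : Fin N, ‖(divB (torusT P i) U (fun μ => covD (torusT P i) U μ wJ) z) j k‖ ^ 2)
      ≤ W * (3 * H + 5 * A * S) := by
  classical
  obtain ⟨hz1, hz2⟩ := sum_hs_zero (P := P) (i := i) (N := N) ω
  -- the objects of the door at `χ = 0`: `U_int = u = U₂ = 0`
  have hUC : ∀ x ∈ C, (fun _ : Site P i => (0 : Matrix (Fin N) (Fin N) ℂ)) x = wJ x := fun x hx => by rw [hwJ0 x hx]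
  have hUel : ∀ x ∉ C, divB (torusT P i) U (fun μ => covD (torusT P i) U μ
      (fun y => divB (torusT P i) U (fun ν => covD (torusT P i) U ν (fun _ : Site P i => (0 : Matrix (Fin N) (Fin N) ℂ))) y)) x = 0 := by
    intro x _
    have e : (fun y => divB (torusT P i) U (fun ν => covD (torusT P i) U ν (fun _ : Site P i => (0 : Matrix (Fin N) (Fin N) ℂ))) y)
        = fun _ : Site P i => (0 : Matrix (Fin N) (Fin N) ℂ) := funext fun y => covLaplace_zero U y
    rw [e, covLaplace_zero]
  have hu : ∀ x ∈ C, (fun _ : Site P i => (0 : Matrix (Fin N) (Fin N) ℂ)) x = (fun _ : Site P i => (0 : ℝ)) x • wJ x := fun x _ => by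
    simp only [zero_smul]
  have hU₂C : ∀ x ∈ C, (fun _ : Site P i => (0 : Matrix (Fin N) (Fin N) ℂ)) x = (fun _ : Site P i => (0 : Matrix (Fin N) (Fin N) ℂ)) x :=
    fun _ _ => rfl
  -- the `hEL` identity of `(1 − 0)•w_J = w_J`: Green's second identity plus the source equation off `C`
  have hELF : ∀ v : Site P i → Matrix (Fin N) (Fin N) ℂ, (∀ y ∈ C, v y = 0) →
      ∑ x, (((divB (torusT P i) U (fun μ => covD (torusT P i) U μ (fun y => (1 - (fun _ : Site P i => (0 : ℝ)) y) • wJ y)) x)ᴴ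
          * divB (torusT P i) U (fun μ => covD (torusT P i) U μ v) x).trace).re
        = ∑ x, (((h x)ᴴ * divB (torusT P i) U (fun μ => covD (torusT P i) U μ v) x).trace).re
          + ∑ x, ∑ μ, ((((fun (_ : Fin P.d) (_ : Site P i) => (0 : Matrix (Fin N) (Fin N) ℂ)) μ x)ᴴ * covD (torusT P i) U μ v x).trace).re
          + ∑ x, (((s x)ᴴ * v x).trace).re := by
    intro v hv
    have e1 : (fun y => (1 - (fun _ : Site P i => (0 : ℝ)) y) • wJ y) = wJ := funext fun y => by simp only [sub_zero, one_smul]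
    rw [e1]
    simp only [Matrix.conjTranspose_zero, zero_mul, Matrix.trace_zero, Complex.zero_re, Finset.sum_const_zero, add_zero]
    -- `Σ⟨Δw_J, Δv⟩ = Σ⟨Δ²w_J, v⟩`
    have h2 := sum_re_trace_covLaplace_comm hU (fun y => divB (torusT P i) U (fun ν => covD (torusT P i) U ν wJ) y) v
    rw [← h2]
    -- pointwise: on `C` both sides vanish (`v = 0`), off `C` the source equation
    have h3 : ∀ x : Site P i, (((divB (torusT P i) U (fun μ => covD (torusT P i) U μ
        (fun y => divB (torusT P i) U (fun ν => covD (torusT P i) U ν wJ) y)) x)ᴴ * v x).trace).re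
          = (((divB (torusT P i) U (fun μ => covD (torusT P i) U μ h) x)ᴴ * v x).trace).re + (((s x)ᴴ * v x).trace).re := by
      intro x
      by_cases hx : x ∈ C
      · rw [hv x hx, mul_zero, mul_zero, mul_zero, Matrix.trace_zero, Complex.zero_re, add_zero]
      · rw [hwJ x hx, reTr_add_left]
    rw [Finset.sum_congr rfl fun x _ => h3 x, Finset.sum_add_distrib, sum_re_trace_covLaplace_comm hU h v]
  -- the vanishing numbers
  have hN₂ : ∑ z, Real.sqrt (∑ j : Fin N, ∑ k : Fin N,
      ‖(divB (torusT P i) U (fun μ => covD (torusT P i) U μ (fun y => (fun _ : Site P i => (0 : ℝ)) y • wJ y)) z) j k‖ ^ 2) ≤ 0 := by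
    have e : (fun y => (fun _ : Site P i => (0 : ℝ)) y • wJ y) = fun _ : Site P i => (0 : Matrix (Fin N) (Fin N) ℂ) :=
      funext fun y => by simp only [zero_smul]
    rw [e]
    simp only [covLaplace_zero, Matrix.zero_apply, norm_zero, ne_eq, OfNat.ofNat_ne_zero, not_false_eq_true, zero_pow, Finset.sum_const_zero,
      Real.sqrt_zero, le_refl]
  have hN₃ : ∑ z, Real.sqrt (∑ j : Fin N, ∑ k : Fin N,
      ‖(divB (torusT P i) U (fun μ => covD (torusT P i) U μ (fun _ : Site P i => (0 : Matrix (Fin N) (Fin N) ℂ))) z) j k‖ ^ 2) ≤ 0 := by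
    simp only [covLaplace_zero, Matrix.zero_apply, norm_zero, ne_eq, OfNat.ofNat_ne_zero, not_false_eq_true, zero_pow, Finset.sum_const_zero,
      Real.sqrt_zero, le_refl]
  have hN₄ : Real.sqrt (∑ x, ω x ^ 2 * ∑ j : Fin N, ∑ k : Fin N,
      ‖(divB (torusT P i) U (fun μ => covD (torusT P i) U μ (fun _ : Site P i => (0 : Matrix (Fin N) (Fin N) ℂ))) x) j k‖ ^ 2) ≤ 0 := by
    simp only [covLaplace_zero, Matrix.zero_apply, norm_zero, ne_eq, OfNat.ofNat_ne_zero, not_false_eq_true, zero_pow, Finset.sum_const_zero,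
      mul_zero, Real.sqrt_zero, le_refl]
  have hdoor := sum_sqrt_hs_covLaplace_sub_interp_le_of_rows_window hU C (fun _ : Site P i => (0 : ℝ)) ω wJ
    (fun _ : Site P i => (0 : Matrix (Fin N) (Fin N) ℂ)) (fun _ : Site P i => (0 : Matrix (Fin N) (Fin N) ℂ)) (fun _ : Site P i => (0 : Matrix (Fin N) (Fin N) ℂ))
    h s (fun (_ : Fin P.d) (_ : Site P i) => (0 : Matrix (Fin N) (Fin N) ℂ)) (Nht := 0) (N₂ := 0) (N₃ := 0) (N₄ := 0)
    ha0 hb0 hA hUC hUel hu hU₂C hUel hELF hω₀ hω₁ hω₂ hP ha hwin₁ hwin₂ hH (by rw [hz2, Real.sqrt_zero]) hS hW hN₂ hN₃ hN₄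
  have e : (fun y => wJ y - (fun _ : Site P i => (0 : Matrix (Fin N) (Fin N) ℂ)) y) = wJ := funext fun y => sub_zero _
  rw [e] at hdoor
  have h0 : W * (3 * H + 5 * Real.sqrt A * 0 + 5 * A * S) + 0 + 0 + W * (3 * 0) = W * (3 * H + 5 * A * S) := by ring
  rw [h0] at hdoor
  exact hdoor

/-! ## §3 ★★★ The assembly: an exactly-sourced pinned dipole field from a transplant with split junk -/

/-- ★★★ **THE (A-cov) ASSEMBLY.**  Unitary `U`, centres `C` with pinned solvability `hsolve` (✓p670409's shape), px4 g3's weight∕Poincaré∕window rows; a bond `(x, μ)` and a test matrix `X`.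
GIVEN a transplant `V` whose covariant bi-Laplacian off `C` is the covariant dipole `δ_{x+e_μ}·R(U_μ x)⁻¹X − δ_x·X` PLUS a split junk `Δ_U h + s` (`hV`), a real cutoff `χ`, a near datum `u` with
`u|_C = (χ•V)|_C`, and the six numbers `√Σω²hs(Δ_U((1−χ)•V)) ≤ N_h`, `Σ√hs(Δ_U(χ•V)) ≤ N₂`, `Σ√hs(Δ_Uu) ≤ N₃`, `√Σω²hs(Δ_Uu) ≤ N₄`, `√Σω²hs(h) ≤ H`, `√Σω²hs(s) ≤ S`:
THERE IS `w` with `w|_C = 0`, `Δ_U²w = dipole` off `C` EXACTLY, and `Σ_z √hs(Δ_Uw z) ≤ W·3N_h + N₂ + N₃ + W·3N₄ + W·(3H + 5A·S)`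
(`w := (V − U_int) − w_J`; `U_int`, `U₂`, `w_J` from `hsolve`; type-1 door ✓p674320 + §2). [cite: Balaban1985RegularSpaces, (1.14) p.78, (1.36) p.82; Balaban1984PropagatorsII, (1.9) p.226;
Balaban1985BackgroundPropagators, (3.3) p.390, (3.8) p.392] -/
theorem exists_pinned_dipole_field_of_transplant (hU : ∀ ν x, (U ν x : Matrix (Fin N) (Fin N) ℂ) ∈ unitary (Matrix (Fin N) (Fin N) ℂ))
    (C : Set (Site P i))
    (hsolve : ∀ g : Site P i → Matrix (Fin N) (Fin N) ℂ, ∃ q : Site P i → Matrix (Fin N) (Fin N) ℂ, (∀ y ∈ C, q y = 0) ∧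
      ∀ z ∉ C, divB (torusT P i) U (fun μ => covD (torusT P i) U μ
        (fun y => divB (torusT P i) U (fun ν => covD (torusT P i) U ν q) y)) z = g z)
    (ω : Site P i → ℝ) {a b A W : ℝ} (ha0 : 0 ≤ a) (hb0 : 0 ≤ b) (hA : 0 ≤ A)
    (hω₀ : ∀ x, 0 < ω x)
    (hω₁ : ∀ x μ, |ω (x.shift μ) - ω x| ≤ a * ω x ∧ |ω (x.unshift μ) - ω x| ≤ a * ω x)
    (hω₂ : ∀ x μ, |ω (x.shift μ) + ω (x.unshift μ) - 2 * ω x| ≤ b * ω x)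
    (hP : ∀ v : Site P i → Matrix (Fin N) (Fin N) ℂ, (∀ y ∈ C, v y = 0) →
      Real.sqrt (∑ x, ∑ j : Fin N, ∑ k : Fin N, ‖(v x) j k‖ ^ 2)
        ≤ A * Real.sqrt (∑ x, ∑ j : Fin N, ∑ k : Fin N, ‖(divB (torusT P i) U (fun μ => covD (torusT P i) U μ v) x) j k‖ ^ 2))
    (ha : a ≤ 1 / 2) (hwin₁ : a * Real.sqrt P.d * Real.sqrt A ≤ 1 / 100) (hwin₂ : b * P.d * A ≤ 1 / 50)
    (hW : Real.sqrt (∑ z, (ω z)⁻¹ ^ 2) ≤ W)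
    -- the bond, the test matrix, the transplant and its junk split
    (μ : Fin P.d) (x : Site P i) (X : Matrix (Fin N) (Fin N) ℂ) (V h s : Site P i → Matrix (Fin N) (Fin N) ℂ)
    (hV : ∀ z ∉ C, divB (torusT P i) U (fun κ => covD (torusT P i) U κ
      (fun y => divB (torusT P i) U (fun ν => covD (torusT P i) U ν V) y)) z
        = ((if z = torusT P i μ x then R (U μ x)⁻¹ X else 0) - (if z = x then X else 0))
          + (divB (torusT P i) U (fun κ => covD (torusT P i) U κ h) z + s z))
    -- the cutoff and the near datum
    (χ : Site P i → ℝ) (u : Site P i → Matrix (Fin N) (Fin N) ℂ) (hu : ∀ y ∈ C, u y = χ y • V y)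
    -- the six numbers
    {Nh N₂ N₃ N₄ H S : ℝ}
    (hNh : Real.sqrt (∑ z, ω z ^ 2 * ∑ j : Fin N, ∑ k : Fin N,
      ‖(divB (torusT P i) U (fun κ => covD (torusT P i) U κ (fun y => (1 - χ y) • V y)) z) j k‖ ^ 2) ≤ Nh)
    (hN₂ : ∑ z, Real.sqrt (∑ j : Fin N, ∑ k : Fin N, ‖(divB (torusT P i) U (fun κ => covD (torusT P i) U κ (fun y => χ y • V y)) z) j k‖ ^ 2) ≤ N₂)
    (hN₃ : ∑ z, Real.sqrt (∑ j : Fin N, ∑ k : Fin N, ‖(divB (torusT P i) U (fun κ => covD (torusT P i) U κ u) z) j k‖ ^ 2) ≤ N₃)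
    (hN₄ : Real.sqrt (∑ z, ω z ^ 2 * ∑ j : Fin N, ∑ k : Fin N, ‖(divB (torusT P i) U (fun κ => covD (torusT P i) U κ u) z) j k‖ ^ 2) ≤ N₄)
    (hH : Real.sqrt (∑ z, ω z ^ 2 * ∑ j : Fin N, ∑ k : Fin N, ‖(h z) j k‖ ^ 2) ≤ H)
    (hS : Real.sqrt (∑ z, ω z ^ 2 * ∑ j : Fin N, ∑ k : Fin N, ‖(s z) j k‖ ^ 2) ≤ S) :
    ∃ w : Site P i → Matrix (Fin N) (Fin N) ℂ, (∀ y ∈ C, w y = 0) ∧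
      (∀ z ∉ C, divB (torusT P i) U (fun κ => covD (torusT P i) U κ
        (fun y => divB (torusT P i) U (fun ν => covD (torusT P i) U ν w) y)) z
          = (if z = torusT P i μ x then R (U μ x)⁻¹ X else 0) - (if z = x then X else 0)) ∧
      ∑ z, Real.sqrt (∑ j : Fin N, ∑ k : Fin N, ‖(divB (torusT P i) U (fun κ => covD (torusT P i) U κ w) z) j k‖ ^ 2)
        ≤ W * (3 * Nh) + N₂ + N₃ + W * (3 * N₄) + W * (3 * H + 5 * A * S) := by
  classical
  -- the pinned correctors of `V` and `u`, and the pinned response of the junk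
  obtain ⟨q₁, hq₁0, hq₁⟩ := hsolve (fun z => divB (torusT P i) U (fun κ => covD (torusT P i) U κ
    (fun y => divB (torusT P i) U (fun ν => covD (torusT P i) U ν V) y)) z)
  obtain ⟨q₂, hq₂0, hq₂⟩ := hsolve (fun z => divB (torusT P i) U (fun κ => covD (torusT P i) U κ
    (fun y => divB (torusT P i) U (fun ν => covD (torusT P i) U ν u) y)) z)
  obtain ⟨wJ, hwJ0, hwJ⟩ := hsolve (fun z => divB (torusT P i) U (fun κ => covD (torusT P i) U κ h) z + s z)
  -- the interpolants `U_int := V − q₁`, `U₂ := u − q₂`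
  have hUC : ∀ y ∈ C, (fun y => V y - q₁ y) y = V y := fun y hy => by simp only [hq₁0 y hy, sub_zero]
  have hUel : ∀ z ∉ C, divB (torusT P i) U (fun κ => covD (torusT P i) U κ
      (fun y => divB (torusT P i) U (fun ν => covD (torusT P i) U ν (fun y => V y - q₁ y)) y)) z = 0 := fun z hz => by
    rw [covBilaplace_sub, hq₁ z hz, sub_self]
  have hU₂C : ∀ y ∈ C, (fun y => u y - q₂ y) y = u y := fun y hy => by simp only [hq₂0 y hy, sub_zero]
  have hU₂el : ∀ z ∉ C, divB (torusT P i) U (fun κ => covD (torusT P i) U κ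
      (fun y => divB (torusT P i) U (fun ν => covD (torusT P i) U ν (fun y => u y - q₂ y)) y)) z = 0 := fun z hz => by
    rw [covBilaplace_sub, hq₂ z hz, sub_self]
  refine ⟨fun y => (V y - (fun y => V y - q₁ y) y) - wJ y, fun y hy => ?_, fun z hz => ?_, ?_⟩
  · simp only [hq₁0 y hy, hwJ0 y hy, sub_zero, sub_self]
  · rw [covBilaplace_sub, covBilaplace_sub, hUel z hz, hwJ z hz, hV z hz]
    abel
  · -- main part: the type-1 door; junk part: §2; then the triangle
    have hmain := sum_sqrt_hs_covLaplace_sub_interp_le_type_one_window hU C χ ω V (fun y => V y - q₁ y) u (fun y => u y - q₂ y)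
      ha0 hb0 hA hUC hUel hu hU₂C hU₂el hω₀ hω₁ hω₂ hP ha hwin₁ hwin₂ hNh hW hN₂ hN₃ hN₄
    have hjunk := sum_sqrt_hs_covLaplace_response_le hU C ω ha0 hb0 hA hω₀ hω₁ hω₂ hP ha hwin₁ hwin₂ hW wJ h s hwJ0 hwJ hH hS
    have htri := sum_sqrt_hs_covLaplace_sub_le (U := U) (fun y => V y - (fun y => V y - q₁ y) y) wJ
    exact htri.trans (by linarith [hmain, hjunk])

/-! ## §4 ★★★ The interpolation row from per-`X` transplant data; the T³ reading in the `hKsup` shape -/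

/-- ★★★ **THE COVARIANT (hK) ROW FROM TRANSPLANT DATA.**  If for EVERY test matrix `X` the (A-cov) programme exports a transplant `V`, its junk split `h s`, a cutoff `χ`, a near datum `u` and six
numbers whose door total is `≤ κ·√hs X`, then for every `φ`, every pinned `Δ_U`-biharmonic interpolant `φ_H` of `φ` and every `s₁ ≥ sup_z √hs(Δ_Uφ z)`:
`√hs(D_U(φ − φ_H)(x,μ)) ≤ κ·s₁` (✓p670099 `sqrt_hs_covD_interp_error_le` with `hker` discharged by §3). [cite: Balaban1985RegularSpaces, (1.36) p.82; Balaban1985BackgroundPropagators, (3.3) p.390] -/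
theorem sqrt_hs_covD_interp_error_le_of_transplant (hU : ∀ ν x, (U ν x : Matrix (Fin N) (Fin N) ℂ) ∈ unitary (Matrix (Fin N) (Fin N) ℂ))
    (C : Set (Site P i))
    (hsolve : ∀ g : Site P i → Matrix (Fin N) (Fin N) ℂ, ∃ q : Site P i → Matrix (Fin N) (Fin N) ℂ, (∀ y ∈ C, q y = 0) ∧
      ∀ z ∉ C, divB (torusT P i) U (fun μ => covD (torusT P i) U μ
        (fun y => divB (torusT P i) U (fun ν => covD (torusT P i) U ν q) y)) z = g z)
    (ω : Site P i → ℝ) {a b A W : ℝ} (ha0 : 0 ≤ a) (hb0 : 0 ≤ b) (hA : 0 ≤ A)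
    (hω₀ : ∀ x, 0 < ω x)
    (hω₁ : ∀ x μ, |ω (x.shift μ) - ω x| ≤ a * ω x ∧ |ω (x.unshift μ) - ω x| ≤ a * ω x)
    (hω₂ : ∀ x μ, |ω (x.shift μ) + ω (x.unshift μ) - 2 * ω x| ≤ b * ω x)
    (hP : ∀ v : Site P i → Matrix (Fin N) (Fin N) ℂ, (∀ y ∈ C, v y = 0) →
      Real.sqrt (∑ x, ∑ j : Fin N, ∑ k : Fin N, ‖(v x) j k‖ ^ 2)
        ≤ A * Real.sqrt (∑ x, ∑ j : Fin N, ∑ k : Fin N, ‖(divB (torusT P i) U (fun μ => covD (torusT P i) U μ v) x) j k‖ ^ 2))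
    (ha : a ≤ 1 / 2) (hwin₁ : a * Real.sqrt P.d * Real.sqrt A ≤ 1 / 100) (hwin₂ : b * P.d * A ≤ 1 / 50)
    (hW : Real.sqrt (∑ z, (ω z)⁻¹ ^ 2) ≤ W)
    (μ : Fin P.d) (x : Site P i) {κ : ℝ} (hκ : 0 ≤ κ)
    -- per-`X` transplant data
    (htr : ∀ X : Matrix (Fin N) (Fin N) ℂ, ∃ (V h s : Site P i → Matrix (Fin N) (Fin N) ℂ) (χ : Site P i → ℝ) (u : Site P i → Matrix (Fin N) (Fin N) ℂ)
        (Nh N₂ N₃ N₄ H S : ℝ),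
      (∀ z ∉ C, divB (torusT P i) U (fun κ' => covD (torusT P i) U κ'
        (fun y => divB (torusT P i) U (fun ν => covD (torusT P i) U ν V) y)) z
          = ((if z = torusT P i μ x then R (U μ x)⁻¹ X else 0) - (if z = x then X else 0))
            + (divB (torusT P i) U (fun κ' => covD (torusT P i) U κ' h) z + s z)) ∧
      (∀ y ∈ C, u y = χ y • V y) ∧
      Real.sqrt (∑ z, ω z ^ 2 * ∑ j : Fin N, ∑ k : Fin N,
        ‖(divB (torusT P i) U (fun κ' => covD (torusT P i) U κ' (fun y => (1 - χ y) • V y)) z) j k‖ ^ 2) ≤ Nh ∧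
      ∑ z, Real.sqrt (∑ j : Fin N, ∑ k : Fin N, ‖(divB (torusT P i) U (fun κ' => covD (torusT P i) U κ' (fun y => χ y • V y)) z) j k‖ ^ 2) ≤ N₂ ∧
      ∑ z, Real.sqrt (∑ j : Fin N, ∑ k : Fin N, ‖(divB (torusT P i) U (fun κ' => covD (torusT P i) U κ' u) z) j k‖ ^ 2) ≤ N₃ ∧
      Real.sqrt (∑ z, ω z ^ 2 * ∑ j : Fin N, ∑ k : Fin N, ‖(divB (torusT P i) U (fun κ' => covD (torusT P i) U κ' u) z) j k‖ ^ 2) ≤ N₄ ∧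
      Real.sqrt (∑ z, ω z ^ 2 * ∑ j : Fin N, ∑ k : Fin N, ‖(h z) j k‖ ^ 2) ≤ H ∧
      Real.sqrt (∑ z, ω z ^ 2 * ∑ j : Fin N, ∑ k : Fin N, ‖(s z) j k‖ ^ 2) ≤ S ∧
      W * (3 * Nh) + N₂ + N₃ + W * (3 * N₄) + W * (3 * H + 5 * A * S) ≤ κ * Real.sqrt (∑ j : Fin N, ∑ k : Fin N, ‖X j k‖ ^ 2))
    -- the potential and its interpolant
    (φ φH : Site P i → Matrix (Fin N) (Fin N) ℂ) (hH : ∀ y ∈ C, φH y = φ y)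
    (hEL : ∀ z ∉ C, divB (torusT P i) U (fun μ => covD (torusT P i) U μ
      (fun y => divB (torusT P i) U (fun ν => covD (torusT P i) U ν φH) y)) z = 0)
    {s₁ : ℝ} (hs₁ : ∀ z, Real.sqrt (∑ j : Fin N, ∑ k : Fin N, ‖(divB (torusT P i) U (fun κ' => covD (torusT P i) U κ' φ) z) j k‖ ^ 2) ≤ s₁) :
    Real.sqrt (∑ j : Fin N, ∑ k : Fin N, ‖(covD (torusT P i) U μ (fun y => φ y - φH y) x) j k‖ ^ 2) ≤ κ * s₁ := by
  refine sqrt_hs_covD_interp_error_le hU C φ φH hH hEL hs₁ μ x hκ fun X => ?_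
  obtain ⟨V, h, s, χ, u, Nh, N₂, N₃, N₄, H, S, hV, hu, hNh, hN₂, hN₃, hN₄, hHn, hSn, htot⟩ := htr X
  obtain ⟨w, hw0, hw, hle⟩ := exists_pinned_dipole_field_of_transplant hU C hsolve ω ha0 hb0 hA hω₀ hω₁ hω₂ hP ha hwin₁ hwin₂ hW μ x X V h s hV
    χ u hu hNh hN₂ hN₃ hN₄ hHn hSn
  exact ⟨w, hw0, hw, hle.trans htot⟩

section T3

open Literature.MathematicalPhysics.QuantumFieldTheory.Balaban1983to89.T3ContinuumYM3Torus (T3Family)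
open B10Eq27TorusAxialLog (unitsField toUField)
open B15DeterminingSets (embIter)
open Summit.QuantumFields.YangMills.Theorems.Prop7CovHodgeSplit (unitsField_toUField_mem_unitary)
open Summit.QuantumFields.YangMills.Theorems.Prop7PinnedCovBiharmonicSolve (exists_pinned_covBilaplace_eq_off_T3)

/-- ★★★ **T³ READING — THE `hKsup` BINDER OF ✓ `Prop7LinearCorrectorClose.linCorr_gauge_le_of_supplier_rows` FROM TRANSPLANT DATA AT THE MEMBER.**  Run `K` of a T³ family, level `K − n`,
ANY `SU(2)` background `W` (`𝒰 := fun κ z => unitsField (toUField W) ⟨z, κ⟩`; pinned solvability by ✓p670409, unitarity by ✓ `unitsField_toUField_mem_unitary`): GIVEN px4 g3's weight∕Poincaré∕window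
rows at the member and, for every bond `(x, μ)` and every `X`, the transplant data with door total `≤ κ·√hs X`, THEN the row `hKsup` holds with this `κ` — verbatim the binder shape.
[cite: Balaban1985Variational, Prop. 7 p.299; Balaban1985RegularSpaces, (1.36) p.82; Balaban1985BackgroundPropagators, (3.3) p.390] -/
theorem hKsup_of_transplant_T3 (F : T3Family) (K n : ℕ) (W : GaugeField (F.P K) 0 (Matrix.specialUnitaryGroup (Fin 2) ℂ))
    (ω : Site (F.P K) 0 → ℝ) {a b A W₀ : ℝ} (ha0 : 0 ≤ a) (hb0 : 0 ≤ b) (hA : 0 ≤ A)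
    (hω₀ : ∀ x, 0 < ω x)
    (hω₁ : ∀ x μ, |ω (x.shift μ) - ω x| ≤ a * ω x ∧ |ω (x.unshift μ) - ω x| ≤ a * ω x)
    (hω₂ : ∀ x μ, |ω (x.shift μ) + ω (x.unshift μ) - 2 * ω x| ≤ b * ω x)
    (hP : ∀ v : Site (F.P K) 0 → Matrix (Fin 2) (Fin 2) ℂ, (∀ y ∈ Set.range (embIter (K - n)), v y = 0) →
      Real.sqrt (∑ x, ∑ j : Fin 2, ∑ k : Fin 2, ‖(v x) j k‖ ^ 2)
        ≤ A * Real.sqrt (∑ x, ∑ j : Fin 2, ∑ k : Fin 2, ‖(divB (torusT (F.P K) 0) (fun κ z => unitsField (toUField W) ⟨z, κ⟩)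
          (fun μ => covD (torusT (F.P K) 0) (fun κ z => unitsField (toUField W) ⟨z, κ⟩) μ v) x) j k‖ ^ 2))
    (ha : a ≤ 1 / 2) (hwin₁ : a * Real.sqrt (F.P K).d * Real.sqrt A ≤ 1 / 100) (hwin₂ : b * (F.P K).d * A ≤ 1 / 50)
    (hW₀ : Real.sqrt (∑ z, (ω z)⁻¹ ^ 2) ≤ W₀)
    {κ : ℝ} (hκ : 0 ≤ κ)
    (htr : ∀ (μ : Fin (F.P K).d) (x : Site (F.P K) 0) (X : Matrix (Fin 2) (Fin 2) ℂ),
      ∃ (V h s : Site (F.P K) 0 → Matrix (Fin 2) (Fin 2) ℂ) (χ : Site (F.P K) 0 → ℝ) (u : Site (F.P K) 0 → Matrix (Fin 2) (Fin 2) ℂ) (Nh N₂ N₃ N₄ H S : ℝ),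
      (∀ z ∉ Set.range (embIter (K - n)), divB (torusT (F.P K) 0) (fun κ z => unitsField (toUField W) ⟨z, κ⟩)
          (fun κ' => covD (torusT (F.P K) 0) (fun κ z => unitsField (toUField W) ⟨z, κ⟩) κ'
            (fun y => divB (torusT (F.P K) 0) (fun κ z => unitsField (toUField W) ⟨z, κ⟩)
              (fun ν => covD (torusT (F.P K) 0) (fun κ z => unitsField (toUField W) ⟨z, κ⟩) ν V) y)) z
          = ((if z = torusT (F.P K) 0 μ x then R (unitsField (toUField W) ⟨x, μ⟩)⁻¹ X else 0) - (if z = x then X else 0))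
            + (divB (torusT (F.P K) 0) (fun κ z => unitsField (toUField W) ⟨z, κ⟩)
                (fun κ' => covD (torusT (F.P K) 0) (fun κ z => unitsField (toUField W) ⟨z, κ⟩) κ' h) z + s z)) ∧
      (∀ y ∈ Set.range (embIter (K - n)), u y = χ y • V y) ∧
      Real.sqrt (∑ z, ω z ^ 2 * ∑ j : Fin 2, ∑ k : Fin 2, ‖(divB (torusT (F.P K) 0) (fun κ z => unitsField (toUField W) ⟨z, κ⟩)
        (fun κ' => covD (torusT (F.P K) 0) (fun κ z => unitsField (toUField W) ⟨z, κ⟩) κ' (fun y => (1 - χ y) • V y)) z) j k‖ ^ 2) ≤ Nh ∧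
      ∑ z, Real.sqrt (∑ j : Fin 2, ∑ k : Fin 2, ‖(divB (torusT (F.P K) 0) (fun κ z => unitsField (toUField W) ⟨z, κ⟩)
        (fun κ' => covD (torusT (F.P K) 0) (fun κ z => unitsField (toUField W) ⟨z, κ⟩) κ' (fun y => χ y • V y)) z) j k‖ ^ 2) ≤ N₂ ∧
      ∑ z, Real.sqrt (∑ j : Fin 2, ∑ k : Fin 2, ‖(divB (torusT (F.P K) 0) (fun κ z => unitsField (toUField W) ⟨z, κ⟩)
        (fun κ' => covD (torusT (F.P K) 0) (fun κ z => unitsField (toUField W) ⟨z, κ⟩) κ' u) z) j k‖ ^ 2) ≤ N₃ ∧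
      Real.sqrt (∑ z, ω z ^ 2 * ∑ j : Fin 2, ∑ k : Fin 2, ‖(divB (torusT (F.P K) 0) (fun κ z => unitsField (toUField W) ⟨z, κ⟩)
        (fun κ' => covD (torusT (F.P K) 0) (fun κ z => unitsField (toUField W) ⟨z, κ⟩) κ' u) z) j k‖ ^ 2) ≤ N₄ ∧
      Real.sqrt (∑ z, ω z ^ 2 * ∑ j : Fin 2, ∑ k : Fin 2, ‖(h z) j k‖ ^ 2) ≤ H ∧
      Real.sqrt (∑ z, ω z ^ 2 * ∑ j : Fin 2, ∑ k : Fin 2, ‖(s z) j k‖ ^ 2) ≤ S ∧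
      W₀ * (3 * Nh) + N₂ + N₃ + W₀ * (3 * N₄) + W₀ * (3 * H + 5 * A * S) ≤ κ * Real.sqrt (∑ j : Fin 2, ∑ k : Fin 2, ‖X j k‖ ^ 2)) :
    ∀ (φ φH : Site (F.P K) 0 → Matrix (Fin 2) (Fin 2) ℂ),
      (∀ y : Site (F.P K) (K - n), φH (embIter (K - n) y) = φ (embIter (K - n) y)) →
      (∀ x : Site (F.P K) 0, x ∉ Set.range (embIter (K - n)) →
        divB (torusT (F.P K) 0) (fun κ z => unitsField (toUField W) ⟨z, κ⟩)
          (fun μ => covD (torusT (F.P K) 0) (fun κ z => unitsField (toUField W) ⟨z, κ⟩) μ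
            (fun y => divB (torusT (F.P K) 0) (fun κ z => unitsField (toUField W) ⟨z, κ⟩)
              (fun ν => covD (torusT (F.P K) 0) (fun κ z => unitsField (toUField W) ⟨z, κ⟩) ν φH) y)) x = 0) →
      ∀ s₁ : ℝ, (∀ z, Real.sqrt (∑ j : Fin 2, ∑ k : Fin 2,
        ‖(divB (torusT (F.P K) 0) (fun κ z => unitsField (toUField W) ⟨z, κ⟩)
          (fun μ => covD (torusT (F.P K) 0) (fun κ z => unitsField (toUField W) ⟨z, κ⟩) μ φ) z) j k‖ ^ 2) ≤ s₁) →
      ∀ (μ : Fin (F.P K).d) (x : Site (F.P K) 0),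
        Real.sqrt (∑ j : Fin 2, ∑ k : Fin 2, ‖(covD (torusT (F.P K) 0) (fun κ z => unitsField (toUField W) ⟨z, κ⟩) μ (fun y => φ y - φH y) x) j k‖ ^ 2) ≤ κ * s₁ := by
  intro φ φH hH hEL s₁ hs₁ μ x
  have hU := fun κ (z : Site (F.P K) 0) => unitsField_toUField_mem_unitary W κ z
  have hsolve : ∀ g : Site (F.P K) 0 → Matrix (Fin 2) (Fin 2) ℂ, ∃ q : Site (F.P K) 0 → Matrix (Fin 2) (Fin 2) ℂ,
      (∀ y ∈ Set.range (embIter (K - n)), q y = 0) ∧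
      ∀ z ∉ Set.range (embIter (K - n)), divB (torusT (F.P K) 0) (fun κ z => unitsField (toUField W) ⟨z, κ⟩)
        (fun μ => covD (torusT (F.P K) 0) (fun κ z => unitsField (toUField W) ⟨z, κ⟩) μ
          (fun y => divB (torusT (F.P K) 0) (fun κ z => unitsField (toUField W) ⟨z, κ⟩)
            (fun ν => covD (torusT (F.P K) 0) (fun κ z => unitsField (toUField W) ⟨z, κ⟩) ν q) y)) z = g z := by
    intro g
    obtain ⟨q, hq0, hq⟩ := exists_pinned_covBilaplace_eq_off_T3 F K (K - n) W g
    refine ⟨q, ?_, hq⟩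
    rintro y ⟨y', rfl⟩
    exact hq0 y'
  have hH' : ∀ y ∈ Set.range (embIter (K - n)), φH y = φ y := by
    rintro y ⟨y', rfl⟩
    exact hH y'
  exact sqrt_hs_covD_interp_error_le_of_transplant hU (Set.range (embIter (K - n))) hsolve ω ha0 hb0 hA hω₀ hω₁ hω₂ hP ha hwin₁ hwin₂ hW₀ μ x hκ
    (htr μ x) φ φH hH' hEL hs₁

end T3

end Summit.QuantumFields.YangMills.Theorems.Prop7CovKernelOfTransplant

end
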